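import Literature.IUT.LogVolume.TensorPacketMeasure
import Literature.MeasureTheory.Lebesgue.IntermediateMeasureValues
import HarnessLib

/-!
# Every real number is the normalised log-measure of an admissible region of a tensor packet

Theorems only (no definitions). For a tensor packet `V = K_{v_0} ⊗_{ℚ_p} ⋯ ⊗_{ℚ_p} K_{v_j}` of `p`-adic fields
(`PacketAlgebra p k`, Dupuy–Hilado Def. 3.6.1) with its chosen decomposition `ψ : V ≃ Π_j L_j`
(`TensorPacketMeasure`: `packetVol`, `PacketAdm` = positive finite measure, `packetLogμ` = the normalised
log-measure `log μ̄ = (1/D)·log μ` of Dupuy–Hilado §3.4), we prove: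

* `exists_isOpen_haar_lt` — `⊕_j L_j` has nonempty open subsets of arbitrarily small Haar measure (the
  polydiscs `p^n·Π_j O_{L_j}`, of measure `c^n` with `c = μ(p·Π O_{L_j}) < 1` by the modulus rule
  [AbsTopIII] Prop. 5.7 (i)(b));
* `haar_finelyDivisible` — hence the Haar measure is finely divisible (countably many translates of such a
  polydisc cover the second countable group `⊕_j L_j`);
* `exists_subset_unitPolydisc_haar_eq` — by Sierpiński's theorem (`Literature.MeasureTheory.Lebesgue.
  exists_subset_measurableSet_measure_eq`) every `t ≤ 1 = μ(Π O_{L_j})` is the measure of a measurable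
  subset of the unit polydisc;
* `exists_packetAdm_packetLogμ_eq` — **every real number `t` is `log μ̄(A)` for some admissible `A ⊆ V`**
  (`t ≤ 0` inside `(R_I)^∼`; general `t` after multiplication by `p^{-m}`, Dupuy–Hilado Rmk. 3.5.4
  `log μ̄(p^n·A) = −n·log p + log μ̄(A)`);
* §4 `haar_finitelyCoverable`, `exists_isCompact_subset_unitPolydisc_haar_eq`,
  `exists_packetAdm_isCompact_packetLogμ_eq(_of_nonpos)` — the same with the region's image in `⊕_j L_j` COMPACT
  ([IUTchIII] Rmk. 3.1.1 (iii) "compact subsets of positive measure"; via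
  `Literature.MeasureTheory.Lebesgue.exists_isCompact_subset_measure_eq`).

Consumer: the abc-iut cell's discharge of [IUTchIII] Thm. 3.11 (i)(c) (degrees of `ℝ`-Arakelov divisors as
log-volumes of admissible regions of the real prime packets). [cite: DupuyHilado2025, Def. 3.6.1, §3.4, Rmk. 3.5.4]
[cite: Sierpinski1922Fonctions, Théorème p. 240] Deliberately NOT here: measurability of the chosen regions beyond
what `PacketAdm` asks (they ARE measurable, recorded in `exists_packetAdm_packetLogμ_eq`'s proof but not exported),
explicit lattice regions (see `packetLogμ_iota_smul`), anything about Cor. 3.12.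
-/

noncomputable section

open MeasureTheory Set Metric Filter Topology
open scoped ENNReal Pointwise

namespace Literature.IUT.LogVolume

open Literature.MeasureTheory.Lebesgue

variable (p : ℕ) [Fact p.Prime]
variable {I : Type} [Fintype I] [DecidableEq I]
variable (k : I → Type) [∀ i, NontriviallyNormedField (k i)] [∀ i, NormedAlgebra ℚ_[p] (k i)]
  [∀ i, IsUltrametricDist (k i)] [∀ i, ProperSpace (k i)]

/-! ## 1. Small open subsets of `⊕_j L_j` -/

section SmallOpens

omit [DecidableEq I] [∀ i, IsUltrametricDist (k i)] in
/-- Multiplication by an element `g` of `⊕_j L_j` with `‖g_j‖ ≤ 1` maps the unit polydisc into itself.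
[cite: MochizukiAbsTopIII2015, Prop. 5.7 (i)(b) p. 138] -/
theorem mul_image_unitPolydisc_subset (g : DSum p k) (hg : ∀ j, ‖g j‖ ≤ 1) :
    (fun y => g * y) '' (piUnitBallStructure (DFac p k) : Set (DSum p k)) ⊆
      (piUnitBallStructure (DFac p k) : Set (DSum p k)) := by
  rintro _ ⟨y, hy, rfl⟩
  rw [coe_piUnitBallStructure, polydisc, Set.mem_univ_pi] at hy ⊢
  intro j
  have h1 := hg j
  have h2 : ‖y j‖ ≤ 1 := by simpa [mem_closedBall_zero_iff] using hy j
  show (g * y) j ∈ closedBall (0 : DFac p k j) 1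
  rw [mem_closedBall_zero_iff, Pi.mul_apply, norm_mul]
  calc ‖g j‖ * ‖y j‖ ≤ 1 * 1 := mul_le_mul h1 h2 (norm_nonneg _) zero_le_one
    _ = 1 := one_mul 1

omit [DecidableEq I] [∀ i, IsUltrametricDist (k i)] in
/-- **The modulus of a contracting unit is `< 1`**: if every component of the unit `u` of `⊕_j L_j` has norm
`< 1`, then `μ(u·Π O_{L_j}) < 1 = μ(Π O_{L_j})` (the polydisc `Π O_{L_j}` minus `u·Π O_{L_j}` contains the
nonempty open set of `y ∈ Π O_{L_j}` with `‖y_{j₀}‖ > ‖u_{j₀}‖`, e.g. `1`).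
[cite: MochizukiAbsTopIII2015, Prop. 5.7 (i)(b) p. 138] -/
theorem haar_mul_image_unitPolydisc_lt_one [Nonempty I] (u : (DSum p k)ˣ) (hu : ∀ j, ‖(u : DSum p k) j‖ < 1) :
    (piUnitBallStructure (DFac p k)).haar
        (mulLeftEquiv p k u '' (piUnitBallStructure (DFac p k) : Set (DSum p k))) < 1 := by
  set Λ := piUnitBallStructure (DFac p k) with hΛ
  obtain ⟨j₀⟩ := (inferInstance : Nonempty (DIdx p k))
  -- the witness set
  set W : Set (DSum p k) := (Λ : Set (DSum p k)) ∩ {y | ‖(u : DSum p k) j₀‖ < ‖y j₀‖} with hW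
  have hWo : IsOpen W :=
    Λ.isOpen.inter (isOpen_lt continuous_const (continuous_norm.comp (continuous_apply j₀)))
  have hWne : W.Nonempty := by
    refine ⟨1, ?_, ?_⟩
    · rw [coe_piUnitBallStructure, polydisc, Set.mem_univ_pi]
      intro j
      simp
    · show ‖(u : DSum p k) j₀‖ < ‖(1 : DSum p k) j₀‖
      rw [Pi.one_apply, norm_one]
      exact hu j₀
  have hWpos : 0 < Λ.haar W := Λ.haar_pos_of_isOpen hWo hWne
  have hSsub : mulLeftEquiv p k u '' (Λ : Set (DSum p k)) ⊆ (Λ : Set (DSum p k)) :=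
    mul_image_unitPolydisc_subset p k (u : DSum p k) fun j => (hu j).le
  have hdisj : Disjoint (mulLeftEquiv p k u '' (Λ : Set (DSum p k))) W := by
    rw [Set.disjoint_left]
    rintro _ ⟨y, hy, rfl⟩ ⟨-, hlt⟩
    have h2 : ‖y j₀‖ ≤ 1 := by
      rw [coe_piUnitBallStructure, polydisc, Set.mem_univ_pi] at hy
      simpa [mem_closedBall_zero_iff] using hy j₀
    have h3 : ‖((u : DSum p k) * y) j₀‖ ≤ ‖(u : DSum p k) j₀‖ := by
      rw [Pi.mul_apply, norm_mul]
      calc ‖(u : DSum p k) j₀‖ * ‖y j₀‖ ≤ ‖(u : DSum p k) j₀‖ * 1 :=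
            mul_le_mul_of_nonneg_left h2 (norm_nonneg _)
        _ = ‖(u : DSum p k) j₀‖ := mul_one _
    exact absurd (lt_of_lt_of_le hlt h3) (lt_irrefl _)
  have hsum : Λ.haar (mulLeftEquiv p k u '' (Λ : Set (DSum p k))) + Λ.haar W ≤ 1 := by
    rw [← Λ.haar_union hWo.measurableSet hdisj, ← Λ.haar_self]
    exact measure_mono (union_subset hSsub inter_subset_left)
  have hfin : Λ.haar (mulLeftEquiv p k u '' (Λ : Set (DSum p k))) ≠ ∞ :=
    ne_top_of_le_ne_top ENNReal.one_ne_top (le_trans le_self_add hsum)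
  exact lt_of_lt_of_le (ENNReal.lt_add_right hfin hWpos.ne') hsum

omit [DecidableEq I] [∀ i, IsUltrametricDist (k i)] in
/-- **Iterated modulus**: `μ(uⁿ·Π O_{L_j}) = μ(u·Π O_{L_j})ⁿ` ([AbsTopIII] Prop. 5.7 (i)(b) `μ(x·A) = μ̇(x)·μ(A)`,
iterated). [cite: MochizukiAbsTopIII2015, Prop. 5.7 (i)(b) p. 138] -/
theorem haar_mul_pow_image_unitPolydisc [Nonempty I] (u : (DSum p k)ˣ) (n : ℕ) :
    (piUnitBallStructure (DFac p k)).haar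
        (mulLeftEquiv p k (u ^ n) '' (piUnitBallStructure (DFac p k) : Set (DSum p k))) =
      (piUnitBallStructure (DFac p k)).haar
        (mulLeftEquiv p k u '' (piUnitBallStructure (DFac p k) : Set (DSum p k))) ^ n := by
  set Λ := piUnitBallStructure (DFac p k) with hΛ
  induction n with
  | zero =>
    rw [pow_zero, pow_zero]
    have h : mulLeftEquiv p k 1 '' (Λ : Set (DSum p k)) = (Λ : Set (DSum p k)) := by
      have h1 : ∀ y : DSum p k, mulLeftEquiv p k 1 y = y := fun y => by
        rw [mulLeftEquiv_apply, Units.val_one, one_mul]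
      rw [Set.image_congr fun y _ => h1 y, Set.image_id']
    rw [h, Λ.haar_self]
  | succ n ih =>
    have h : mulLeftEquiv p k (u ^ (n + 1)) '' (Λ : Set (DSum p k)) =
        mulLeftEquiv p k u '' (mulLeftEquiv p k (u ^ n) '' (Λ : Set (DSum p k))) := by
      rw [Set.image_image]
      refine Set.image_congr fun y _ => ?_
      rw [mulLeftEquiv_apply, mulLeftEquiv_apply, mulLeftEquiv_apply, Units.val_pow_eq_pow_val,
        Units.val_pow_eq_pow_val, pow_succ', mul_assoc]
    rw [h, Λ.haar_image (mulLeftEquiv p k u), ih, pow_succ']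

omit [DecidableEq I] [∀ i, IsUltrametricDist (k i)] in
/-- **Nonempty open sets of arbitrarily small measure** in `⊕_j L_j`: the polydiscs `pⁿ·Π O_{L_j}`.
[cite: MochizukiAbsTopIII2015, Prop. 5.7 (i)(b) p. 138] -/
theorem exists_isOpen_haar_lt [Nonempty I] (ε : ℝ≥0∞) (hε : ε ≠ 0) :
    ∃ S : Set (DSum p k), IsOpen S ∧ S.Nonempty ∧ (piUnitBallStructure (DFac p k)).haar S < ε := by
  set Λ := piUnitBallStructure (DFac p k) with hΛ
  -- the unit `(p)_j`
  let u : (DSum p k)ˣ := unitOfNe p k (fun j => (p : DFac p k j)) fun j => prime_ne_zero p (DFac p k j)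
  have hu : ∀ j, ‖(u : DSum p k) j‖ < 1 := fun j => norm_prime_lt_one p (DFac p k j)
  have hc : Λ.haar (mulLeftEquiv p k u '' (Λ : Set (DSum p k))) < 1 :=
    haar_mul_image_unitPolydisc_lt_one p k u hu
  have hlim := ENNReal.tendsto_pow_atTop_nhds_zero_of_lt_one hc
  obtain ⟨n, hn⟩ := ((tendsto_order.1 hlim).2 ε (pos_iff_ne_zero.2 hε)).exists
  refine ⟨mulLeftEquiv p k (u ^ n) '' (Λ : Set (DSum p k)),
    (mulLeftEquiv p k (u ^ n)).toHomeomorph.isOpenMap _ Λ.isOpen, Λ.nonempty.image _, ?_⟩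
  rw [haar_mul_pow_image_unitPolydisc p k u n]
  exact hn

end SmallOpens

/-! ## 2. Fine divisibility and intermediate values of the Haar measure of `⊕_j L_j` -/

section Values

variable [Nonempty I]

omit [DecidableEq I] [∀ i, IsUltrametricDist (k i)] in
/-- **The Haar measure of `⊕_j L_j` is finely divisible**: every measurable set of positive measure contains
measurable subsets of arbitrarily small positive measure (intersect with a suitable translate of a small
polydisc: countably many translates cover). [cite: Sierpinski1922Fonctions, Théorème p. 240 (hypothesis)] -/
theorem haar_finelyDivisible (E : Set (DSum p k)) (hE : MeasurableSet E)
    (hE0 : (piUnitBallStructure (DFac p k)).haar E ≠ 0) (ε : ℝ≥0∞) (hε : ε ≠ 0) :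
    ∃ F ⊆ E, MeasurableSet F ∧ (piUnitBallStructure (DFac p k)).haar F ≠ 0 ∧
      (piUnitBallStructure (DFac p k)).haar F < ε := by
  set Λ := piUnitBallStructure (DFac p k) with hΛ
  obtain ⟨S, hSo, ⟨s₀, hs₀⟩, hSε⟩ := exists_isOpen_haar_lt p k ε hε
  -- countably many translates of `S` cover
  obtain ⟨T, hTc, hTU⟩ :=
    TopologicalSpace.isOpen_iUnion_countable (fun x : DSum p k => x +ᵥ S) fun x => hSo.vadd x
  have hcover : (⋃ x : DSum p k, x +ᵥ S) = univ := by
    refine Set.eq_univ_of_forall fun y => Set.mem_iUnion.2 ⟨y - s₀, ?_⟩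
    exact ⟨s₀, hs₀, by simp [vadd_eq_add]⟩
  rw [hcover] at hTU
  -- some translate meets `E` in positive measure
  by_contra hcon
  push Not at hcon
  have hnull : ∀ x ∈ T, Λ.haar (E ∩ (x +ᵥ S)) = 0 := by
    intro x hx
    by_contra h0
    have hlt : Λ.haar (E ∩ (x +ᵥ S)) < ε :=
      lt_of_le_of_lt (measure_mono inter_subset_right) (by rwa [Λ.haar_vadd])
    exact absurd hlt (not_lt.2 (hcon (E ∩ (x +ᵥ S)) inter_subset_left
      (hE.inter (hSo.vadd x).measurableSet) h0))
  have hEsub : E ⊆ ⋃ x ∈ T, E ∩ (x +ᵥ S) := by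
    intro y hy
    have hy' : y ∈ ⋃ x ∈ T, x +ᵥ S := by rw [hTU]; exact mem_univ y
    obtain ⟨x, hx, hyx⟩ := Set.mem_iUnion₂.1 hy'
    exact Set.mem_iUnion₂.2 ⟨x, hx, hy, hyx⟩
  have h0 : Λ.haar (⋃ x ∈ T, E ∩ (x +ᵥ S)) = 0 := (measure_biUnion_null_iff hTc).2 hnull
  exact hE0 (measure_mono_null hEsub h0)

omit [DecidableEq I] [∀ i, IsUltrametricDist (k i)] in
/-- **Every `t ≤ 1` is the measure of a measurable subset of the unit polydisc `Π_j O_{L_j}`** (Sierpiński's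
theorem for the finely divisible Haar measure of `⊕_j L_j`). [cite: Sierpinski1922Fonctions, Théorème p. 240] -/
theorem exists_subset_unitPolydisc_haar_eq {t : ℝ≥0∞} (ht : t ≤ 1) :
    ∃ B ⊆ (piUnitBallStructure (DFac p k) : Set (DSum p k)), MeasurableSet B ∧
      (piUnitBallStructure (DFac p k)).haar B = t := by
  set Λ := piUnitBallStructure (DFac p k) with hΛ
  refine exists_subset_measurableSet_measure_eq Λ.haar Λ.measurableSet (by rw [Λ.haar_self]; simp)
    (fun E _ hE hE0 ε hε => haar_finelyDivisible p k E hE hE0 ε hε) ?_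
  rwa [Λ.haar_self]

/-! ## 3. Every real number is a normalised log-measure -/

/-- Every `t ≤ 0` is `log μ̄(A)` for an admissible `A ⊆ (R_I)^∼`: take `ψ(A)` a measurable subset of the unit
polydisc of measure `exp(D·t) ≤ 1`. [cite: DupuyHilado2025, §3.4, Def. 3.6.1] -/
theorem exists_packetAdm_packetLogμ_eq_of_nonpos {t : ℝ} (ht : t ≤ 0) :
    ∃ A : Set (PacketAlgebra p k), A ⊆ (normalizedPacket p k : Set (PacketAlgebra p k)) ∧
      PacketAdm p k A ∧ packetLogμ p k A = t := by
  set Λ := piUnitBallStructure (DFac p k) with hΛ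
  have hDpos : (0 : ℝ) < packetDegree p (DFac p k) := by exact_mod_cast packetDegree_pos p (DFac p k)
  set s : ℝ := Real.exp (packetDegree p (DFac p k) * t) with hs
  have hs0 : 0 < s := Real.exp_pos _
  have hs1 : s ≤ 1 := by
    rw [hs, Real.exp_le_one_iff]
    exact mul_nonpos_of_nonneg_of_nonpos hDpos.le ht
  obtain ⟨B, hBsub, hBm, hB⟩ :=
    exists_subset_unitPolydisc_haar_eq p k (t := ENNReal.ofReal s) (by simpa using hs1)
  refine ⟨(dEquiv p k).symm '' B, ?_, ?_, ?_⟩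
  · intro x hx
    obtain ⟨y, hy, rfl⟩ := hx
    have hy' : y ∈ dEquiv p k '' (normalizedPacket p k : Set (PacketAlgebra p k)) := by
      rw [image_normalizedPacket_eq_coe]; exact hBsub hy
    obtain ⟨z, hz, rfl⟩ := hy'
    simpa using hz
  · have himg : dEquiv p k '' ((dEquiv p k).symm '' B) = B := by
      rw [Set.image_image]; simp
    refine ⟨?_, ?_⟩
    · rw [packetVol, himg, hB]; simpa using hs0
    · rw [packetVol, himg, hB]; exact ENNReal.ofReal_lt_top
  · have himg : dEquiv p k '' ((dEquiv p k).symm '' B) = B := by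
      rw [Set.image_image]; simp
    rw [packetLogμ_eq, IntegralStructure.normalizedLogVolume, IntegralStructure.logVolume, himg, hB,
      ENNReal.toReal_ofReal hs0.le, hs, Real.log_exp]
    exact mul_div_cancel_left₀ t hDpos.ne'

/-- **Every real number is the normalised log-measure of an admissible region of the tensor packet**:
`∀ t, ∃ A, PacketAdm A ∧ log μ̄(A) = t` (values `≤ 0` inside `(R_I)^∼`, then scale by `p^{-m}`,
`log μ̄(p^n·A) = −n·log p + log μ̄(A)`). [cite: DupuyHilado2025, Rmk. 3.5.4, Def. 3.6.1] -/
theorem exists_packetAdm_packetLogμ_eq (t : ℝ) :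
    ∃ A : Set (PacketAlgebra p k), PacketAdm p k A ∧ packetLogμ p k A = t := by
  have hp : (0 : ℝ) < Real.log p := Real.log_pos (by exact_mod_cast (Fact.out : p.Prime).one_lt)
  set m : ℕ := ⌈t / Real.log p⌉₊ with hm
  have ht0 : t - m * Real.log p ≤ 0 := by
    have h1 : t / Real.log p ≤ m := Nat.le_ceil _
    rw [div_le_iff₀ hp] at h1
    linarith
  obtain ⟨A₀, -, hA₀, hlog⟩ := exists_packetAdm_packetLogμ_eq_of_nonpos p k ht0
  have hg : ∀ j, dEquiv p k (ppow p k (-(m : ℤ))) j ≠ 0 := fun j => by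
    rw [psi_ppow_apply]
    exact zpow_ne_zero _ (prime_ne_zero p (DFac p k j))
  refine ⟨ppow p k (-(m : ℤ)) • A₀, packetAdm_smul p k _ hg hA₀, ?_⟩
  rw [packetLogμ_ppow_smul p k (-(m : ℤ)) hA₀, hlog]
  push_cast
  ring

/-! ## 4. COMPACT regions of prescribed measure ([IUTchIII] Rmk. 3.1.1 (iii): "compact subsets of positive measure") -/

omit [DecidableEq I] [∀ i, IsUltrametricDist (k i)] in
/-- **Compact sets are finitely covered by translates of an arbitrarily small open polydisc**, so the Haar measure
of `⊕_j L_j` is finely coverable in the sense of `Literature.MeasureTheory.Lebesgue.exists_isCompact_subset_measure_eq`.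
[cite: MochizukiAbsTopIII2015, Prop. 5.7 (i)(b) p. 138] -/
theorem haar_finitelyCoverable (K : Set (DSum p k)) (hK : IsCompact K) (δ : ℝ≥0∞) (hδ : δ ≠ 0) :
    ∃ t : Finset (Set (DSum p k)), (∀ O ∈ t, IsOpen O ∧ (piUnitBallStructure (DFac p k)).haar O < δ) ∧
      K ⊆ ⋃ O ∈ t, O := by
  classical
  set Λ := piUnitBallStructure (DFac p k) with hΛ
  obtain ⟨S, hSo, ⟨s₀, hs₀⟩, hSδ⟩ := exists_isOpen_haar_lt p k δ hδ
  have hcover : K ⊆ ⋃ x : DSum p k, x +ᵥ S := fun y _ =>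
    Set.mem_iUnion.2 ⟨y - s₀, ⟨s₀, hs₀, by simp [vadd_eq_add]⟩⟩
  obtain ⟨T, hT⟩ := hK.elim_finite_subcover (fun x : DSum p k => x +ᵥ S) (fun x => hSo.vadd x) hcover
  refine ⟨T.image fun x => x +ᵥ S, ?_, ?_⟩
  · intro O hO
    obtain ⟨x, -, rfl⟩ := Finset.mem_image.1 hO
    exact ⟨hSo.vadd x, by rwa [Λ.haar_vadd]⟩
  · intro y hy
    obtain ⟨x, hx, hyx⟩ := Set.mem_iUnion₂.1 (hT hy)
    exact Set.mem_iUnion₂.2 ⟨x +ᵥ S, Finset.mem_image.2 ⟨x, hx, rfl⟩, hyx⟩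

omit [DecidableEq I] [∀ i, IsUltrametricDist (k i)] in
/-- **Every `t ≤ 1` is the measure of a COMPACT subset of the unit polydisc `Π_j O_{L_j}`.**
[cite: Sierpinski1922Fonctions, Théorème p. 240 (compact variant)] -/
theorem exists_isCompact_subset_unitPolydisc_haar_eq {t : ℝ≥0∞} (ht : t ≤ 1) :
    ∃ K ⊆ (piUnitBallStructure (DFac p k) : Set (DSum p k)), IsCompact K ∧
      (piUnitBallStructure (DFac p k)).haar K = t := by
  set Λ := piUnitBallStructure (DFac p k) with hΛ
  exact exists_isCompact_subset_measure_eq Λ.haar (haar_finitelyCoverable p k) Λ.isCompact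
    (by rw [Λ.haar_self]; simp) (by rwa [Λ.haar_self])

/-- Every `t ≤ 0` is `log μ̄(A)` for an admissible `A ⊆ (R_I)^∼` WHOSE IMAGE `ψ(A) ⊆ Π O_{L_j}` IS COMPACT.
[cite: DupuyHilado2025, §3.4, Def. 3.6.1] -/
theorem exists_packetAdm_isCompact_packetLogμ_eq_of_nonpos {t : ℝ} (ht : t ≤ 0) :
    ∃ A : Set (PacketAlgebra p k), A ⊆ (normalizedPacket p k : Set (PacketAlgebra p k)) ∧
      PacketAdm p k A ∧ IsCompact (dEquiv p k '' A) ∧ packetLogμ p k A = t := by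
  set Λ := piUnitBallStructure (DFac p k) with hΛ
  have hDpos : (0 : ℝ) < packetDegree p (DFac p k) := by exact_mod_cast packetDegree_pos p (DFac p k)
  set s : ℝ := Real.exp (packetDegree p (DFac p k) * t) with hs
  have hs0 : 0 < s := Real.exp_pos _
  have hs1 : s ≤ 1 := by
    rw [hs, Real.exp_le_one_iff]
    exact mul_nonpos_of_nonneg_of_nonpos hDpos.le ht
  obtain ⟨B, hBsub, hBc, hB⟩ :=
    exists_isCompact_subset_unitPolydisc_haar_eq p k (t := ENNReal.ofReal s) (by simpa using hs1)
  have himg : dEquiv p k '' ((dEquiv p k).symm '' B) = B := by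
    rw [Set.image_image]; simp
  refine ⟨(dEquiv p k).symm '' B, ?_, ?_, ?_, ?_⟩
  · intro x hx
    obtain ⟨y, hy, rfl⟩ := hx
    have hy' : y ∈ dEquiv p k '' (normalizedPacket p k : Set (PacketAlgebra p k)) := by
      rw [image_normalizedPacket_eq_coe]; exact hBsub hy
    obtain ⟨z, hz, rfl⟩ := hy'
    simpa using hz
  · refine ⟨?_, ?_⟩
    · rw [packetVol, himg, hB]; simpa using hs0
    · rw [packetVol, himg, hB]; exact ENNReal.ofReal_lt_top
  · rwa [himg]
  · rw [packetLogμ_eq, IntegralStructure.normalizedLogVolume, IntegralStructure.logVolume, himg, hB,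
      ENNReal.toReal_ofReal hs0.le, hs, Real.log_exp]
    exact mul_div_cancel_left₀ t hDpos.ne'

/-- **Every real number is the normalised log-measure of an admissible region of the tensor packet WITH COMPACT
IMAGE in `⊕_j L_j`** — print's "compact subsets of positive measure" ([IUTchIII] Rmk. 3.1.1 (iii)) read through the
decomposition `ψ`: the compact region of `exists_packetAdm_isCompact_packetLogμ_eq_of_nonpos` translated by `p^{-m}`
(a homeomorphism of `⊕_j L_j`). [cite: DupuyHilado2025, Rmk. 3.5.4, Def. 3.6.1] -/
theorem exists_packetAdm_isCompact_packetLogμ_eq (t : ℝ) :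
    ∃ A : Set (PacketAlgebra p k), PacketAdm p k A ∧ IsCompact (dEquiv p k '' A) ∧ packetLogμ p k A = t := by
  have hp : (0 : ℝ) < Real.log p := Real.log_pos (by exact_mod_cast (Fact.out : p.Prime).one_lt)
  set m : ℕ := ⌈t / Real.log p⌉₊ with hm
  have ht0 : t - m * Real.log p ≤ 0 := by
    have h1 : t / Real.log p ≤ m := Nat.le_ceil _
    rw [div_le_iff₀ hp] at h1
    linarith
  obtain ⟨A₀, -, hA₀, hA₀c, hlog⟩ := exists_packetAdm_isCompact_packetLogμ_eq_of_nonpos p k ht0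
  have hg : ∀ j, dEquiv p k (ppow p k (-(m : ℤ))) j ≠ 0 := fun j => by
    rw [psi_ppow_apply]
    exact zpow_ne_zero _ (prime_ne_zero p (DFac p k j))
  refine ⟨ppow p k (-(m : ℤ)) • A₀, packetAdm_smul p k _ hg hA₀, ?_, ?_⟩
  · rw [image_smul_eq]
    exact hA₀c.image (continuous_const.mul continuous_id)
  · rw [packetLogμ_ppow_smul p k (-(m : ℤ)) hA₀, hlog]
    push_cast
    ring


end Values

end Literature.IUT.LogVolume

end
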